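import Mathlib.Analysis.InnerProductSpace.PiL2
import Mathlib.Analysis.Convex.Jensen
import Literature.Geometry.DiscreteGeometry.KissingPatterns
import HarnessLib

/-!
# The nearest-neighbour (broken-bond) surface tension of the fcc packing, `φ_fcc`

Topic `Literature/MathematicalPhysics/StatisticalMechanics`; companion of `StickyWulffConstants.lean`
(the Cicalese–Kreutz–Leonardi surface constants `∛432`, `(3/2)∛130`) and of
`Literature/Geometry/DiscreteGeometry/KissingPatterns.lean` (the cuboctahedron `fccKissingPattern` =
the twelve unit bond vectors `(±1, ±1, 0)/√2, …` of the fcc packing with nearest-neighbour distance `1`).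
Asked for by the cell `crystal3d-full` (D-0046): planner `run/shared/lean/pub/crystal3d-full/cf-p1/`
ROUTE.md «Definition requests» ("surface tension as a decl: `phiFcc ν := (√2/4)·Σ |⟪w,ν⟫|` and the
kernel lemma `wulffSupport = phiFcc`"), referee audit (erratum E-1 `h_W ≡ phiFcc`), pre-registration
`cf-p2/PREREG.md` (anchor S0-W).

## Sources, as printed

* M. Cicalese, L. Kreutz, G. P. Leonardi, *Emergence of Wulff-crystals from atomistic systems on the
  FCC and HCP lattices*, Comm. Math. Phys. 402 (2023) = arXiv:2204.12892 [CicaleseKreutzLeonardi2023],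
  Proposition 2.4, (23) (arXiv p. 10, verbatim):
  "`ϕ_FCC(ν) = |ν₁ + ν₂| + |ν₁ + ν₃| + |ν₂ + ν₃| + |ν₁ − ν₂| + |ν₁ − ν₃| + |ν₂ − ν₃|`",
  obtained in the proof (Step 1, p. 11) as "`ϕ_FCC(ν) = ½√2 Σ_{ξ ∈ N_FCC} |⟨ξ, ν⟩|`" over the twelve
  nearest-neighbour vectors `N_FCC`; "In particular, `W_FCC` is a truncated octahedron" (p. 10).
* J. K. Mackenzie, A. J. W. Moore, J. F. Nicholas, J. Phys. Chem. Solids 23 (1962) 185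
  [MackenzieMooreNicholas1962]: the number of broken nearest-neighbour bonds per unit area of a planar
  cut with normal `ν` is `(ρ/2) Σ_b |⟨b, ν⟩|` over the bond vectors `b`; the same formula is
  eq. (26.30) of D. Wolf, J. A. Jaszczak, ch. 26 of *Materials Interfaces* (Chapman & Hall 1992)
  [WolfJaszczak1992], whose Table 26.1 prints `C(1)/a² = 6.93, 8.00, 8.48, 8.44` for the cuts
  `(111), (100), (110), (113)` (`a = √2` = cubic lattice parameter at nearest-neighbour distance `1`)
  — i.e. `4·φ_fcc/‖ν‖` of this file: `4√3, 8, 6√2, 28/√11`.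
* R. Alicandro, A. Braides, M. Cicalese, M. Solci, *Discrete Variational Problems with Interfaces*
  (CUP 2023) [AlicandroBraidesCicaleseSolci2023], Theorem 3.1 and §3.1 «crystalline norms»: for
  nearest-neighbour ferromagnetic interactions on a Bravais lattice the surface energy density is
  `Σ_b c_b |⟨b, ν⟩|`, the support function of a zonotope.

## Normalisation (the cell's "deficiency units")

For a finite `X ⊂ L_FCC` (nearest-neighbour distance `1`) with `C(X)` contact pairs the deficiency is
`D(X) = 6·#X − C(X) = ½ Σ_x (12 − deg x)` (`StickyWulffConstants.contactDeficiency`).  A half-crystal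
bounded by a plane with unit normal `ν` loses, per unit area, `½ · (ρ/2) Σ_b |⟨b, ν⟩|` of deficiency
(`ρ = √2` the number density, `b` over the twelve unit bond vectors): this is
`φ_fcc(ν) = (√2/4) Σ_b |⟨b, ν⟩| = ½ ϕ_FCC(ν)` (`phiFcc_eq_bondSum`; the factor `½` against (23) is
the one between `Σ_x (12 − deg x)` and `D`, see the module docstring of `StickyWulffConstants.lean`).
Values per unit area: `(100) ↦ 2`, `(110) ↦ 3/√2`, `(111) ↦ √3`, `(113) ↦ 7/√11`, `(210) ↦ √5`;
on the unit sphere `√3 ≤ φ_fcc ≤ √5` (both sharp).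

## Contents (namespace `Literature.MathematicalPhysics.StatisticalMechanics`)

* `phiFcc` — the definition (printed form (23) divided by `2`);
  `phiFcc_eq_sum_max : φ_fcc(ν) = max(|ν₀|,|ν₁|) + max(|ν₀|,|ν₂|) + max(|ν₁|,|ν₂|)`;
* norm-like API: `phiFcc_nonneg`, `phiFcc_neg`, `phiFcc_smul`, `phiFcc_add_le`, `convexOn_phiFcc`,
  the sharp Euclidean comparison `sqrt_three_mul_norm_le_phiFcc`, `phiFcc_le_sqrt_five_mul_norm`,
  and `phiFcc_eq_zero_iff`;
* values on the integer normals `(1,0,0), (1,1,0), (1,1,1), (1,1,3), (2,1,0)`;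
* `phiFcc_eq_bondSum` — `φ_fcc(ν) = (√2/4) Σ_{b ∈ fccKissingPattern} |⟪b, ν⟫|` (the bond-counting form
  over the tree's cuboctahedron);
* the Wulff body: `truncOctVertexInt` (the `24` integer points `perm(0, ±1, ±2)`), `fccWulffBody` =
  their convex hull (a truncated octahedron of volume `32`), and `φ_fcc` as its support function:
  `inner_intVec_le_phiFcc`, `exists_truncOctVertex_inner_eq_phiFcc`, `phiFcc_eq_sup_truncOctVertex`,
  `inner_le_phiFcc_of_mem_fccWulffBody`, `isGreatest_inner_fccWulffBody`.

WHAT IS NOT HERE: the Γ-convergence theorem of [CicaleseKreutzLeonardi2023] (named fact in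
`StickyWulffConstants.lean`), the polar `ϕ°_FCC` (24), the hcp density (26), the volume / surface
integral of the Wulff body (the constant `∛432` lives in `StickyWulffConstants.lean`), anything
off-lattice.  No named fact is introduced: every statement below is proved.
-/

noncomputable section

namespace Literature.MathematicalPhysics.StatisticalMechanics

open Finset
open scoped RealInnerProductSpace
open Literature.Geometry.DiscreteGeometry (intVec intVec_apply fccInt fccKissingPattern scaledPattern
  scaledPattern_map_injective)

/-! ### The definition and its `max` form -/

/-- **The fcc nearest-neighbour surface tension** `φ_fcc(ν)` in deficiency units (nearest-neighbour
distance `1`): one half of the printed density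
`ϕ_FCC(ν) = |ν₁ + ν₂| + |ν₁ + ν₃| + |ν₂ + ν₃| + |ν₁ − ν₂| + |ν₁ − ν₃| + |ν₂ − ν₃|`
(coordinates written `ν 0, ν 1, ν 2`).  Defined on all of `ℝ³`, positively homogeneous of degree one;
the surface tension proper is its restriction to unit normals.
[cite: CicaleseKreutzLeonardi2023, Proposition 2.4 (23)] -/
def phiFcc (ν : EuclideanSpace ℝ (Fin 3)) : ℝ :=
  (|ν 0 + ν 1| + |ν 0 - ν 1| + |ν 0 + ν 2| + |ν 0 - ν 2| + |ν 1 + ν 2| + |ν 1 - ν 2|) / 2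

/-- `|a + b| + |a − b| = 2 max(|a|, |b|)`. [folklore] -/
private theorem abs_add_add_abs_sub_eq (a b : ℝ) : |a + b| + |a - b| = 2 * max |a| |b| := by
  rcases le_total 0 (a + b) with h1 | h1 <;> rcases le_total 0 (a - b) with h2 | h2 <;>
    rcases le_total 0 a with h3 | h3 <;> rcases le_total 0 b with h4 | h4 <;>
    simp only [abs_of_nonneg, abs_of_nonpos, h1, h2, h3, h4, max_def] <;>
    split_ifs <;> linarith

/-- **`max` form:** `φ_fcc(ν) = max(|ν₀|,|ν₁|) + max(|ν₀|,|ν₂|) + max(|ν₁|,|ν₂|)` — each coordinate pair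
contributes its larger absolute coordinate; with the absolute coordinates sorted as `a ≥ b ≥ c` this is
`2a + b` (the printed reduction "we can as well assume that `0 ≤ ν₁ ≤ ν₂ ≤ ν₃`, so that condition
`ϕ_FCC(ν) ≤ 1` becomes equivalent to `4ν₃ + 2ν₂ ≤ 1`", i.e. `ϕ_FCC = 4a + 2b = 2 φ_fcc`; for an integer
normal `(h, k, l)`, `h ≥ k ≥ l ≥ 0`, this is the classical `2h + k` law of Mackenzie–Moore–Nicholas).
[cite: CicaleseKreutzLeonardi2023, proof of Proposition 2.4, Step 2] -/
theorem phiFcc_eq_sum_max (ν : EuclideanSpace ℝ (Fin 3)) :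
    phiFcc ν = max |ν 0| |ν 1| + max |ν 0| |ν 2| + max |ν 1| |ν 2| := by
  unfold phiFcc
  have h01 := abs_add_add_abs_sub_eq (ν 0) (ν 1)
  have h02 := abs_add_add_abs_sub_eq (ν 0) (ν 2)
  have h12 := abs_add_add_abs_sub_eq (ν 1) (ν 2)
  linarith

/-! ### Norm-like properties -/

/-- `φ_fcc ≥ 0` (the printed density takes values in `[0, +∞]`). [cite: CicaleseKreutzLeonardi2023, §2 (20)] -/
theorem phiFcc_nonneg (ν : EuclideanSpace ℝ (Fin 3)) : 0 ≤ phiFcc ν := by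
  unfold phiFcc; positivity

/-- `φ_fcc(−ν) = φ_fcc(ν)`: the case `g = −id` of the printed invariance "`ϕ_FCC(g(ν)) = ϕ_FCC(ν)` for all
`g ∈ G`" (signed permutations of the coordinates). [cite: CicaleseKreutzLeonardi2023, proof of Proposition 2.4, Step 2] -/
theorem phiFcc_neg (ν : EuclideanSpace ℝ (Fin 3)) : phiFcc (-ν) = phiFcc ν := by
  have hn : ∀ i, (-ν) i = -ν i := fun _ => rfl
  simp only [phiFcc, hn]
  rw [show -ν 0 + -ν 1 = -(ν 0 + ν 1) by ring, show -ν 0 - -ν 1 = -(ν 0 - ν 1) by ring,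
    show -ν 0 + -ν 2 = -(ν 0 + ν 2) by ring, show -ν 0 - -ν 2 = -(ν 0 - ν 2) by ring,
    show -ν 1 + -ν 2 = -(ν 1 + ν 2) by ring, show -ν 1 - -ν 2 = -(ν 1 - ν 2) by ring]
  simp only [abs_neg]

/-- Positive homogeneity of degree one (with the evenness): `φ_fcc(c ν) = |c| φ_fcc(ν)` ("the convex
positively homogeneous function of degree one", (20)). [cite: CicaleseKreutzLeonardi2023, §2 (20)] -/
theorem phiFcc_smul (c : ℝ) (ν : EuclideanSpace ℝ (Fin 3)) : phiFcc (c • ν) = |c| * phiFcc ν := by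
  have hs : ∀ i, (c • ν) i = c * ν i := fun _ => rfl
  simp only [phiFcc, hs]
  rw [← mul_add, ← mul_sub, ← mul_add, ← mul_sub, ← mul_add, ← mul_sub]
  simp only [abs_mul]
  ring

/-- Subadditivity: `φ_fcc(ν + μ) ≤ φ_fcc(ν) + φ_fcc(μ)` (convexity of the printed density, (20)).
[cite: CicaleseKreutzLeonardi2023, §2 (20)] -/
theorem phiFcc_add_le (ν μ : EuclideanSpace ℝ (Fin 3)) : phiFcc (ν + μ) ≤ phiFcc ν + phiFcc μ := by
  have ha : ∀ i, (ν + μ) i = ν i + μ i := fun _ => rfl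
  simp only [phiFcc, ha]
  have h1 := abs_add_le (ν 0 + ν 1) (μ 0 + μ 1)
  have h2 := abs_add_le (ν 0 - ν 1) (μ 0 - μ 1)
  have h3 := abs_add_le (ν 0 + ν 2) (μ 0 + μ 2)
  have h4 := abs_add_le (ν 0 - ν 2) (μ 0 - μ 2)
  have h5 := abs_add_le (ν 1 + ν 2) (μ 1 + μ 2)
  have h6 := abs_add_le (ν 1 - ν 2) (μ 1 - μ 2)
  rw [show ν 0 + μ 0 + (ν 1 + μ 1) = ν 0 + ν 1 + (μ 0 + μ 1) by ring,
    show ν 0 + μ 0 - (ν 1 + μ 1) = ν 0 - ν 1 + (μ 0 - μ 1) by ring,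
    show ν 0 + μ 0 + (ν 2 + μ 2) = ν 0 + ν 2 + (μ 0 + μ 2) by ring,
    show ν 0 + μ 0 - (ν 2 + μ 2) = ν 0 - ν 2 + (μ 0 - μ 2) by ring,
    show ν 1 + μ 1 + (ν 2 + μ 2) = ν 1 + ν 2 + (μ 1 + μ 2) by ring,
    show ν 1 + μ 1 - (ν 2 + μ 2) = ν 1 - ν 2 + (μ 1 - μ 2) by ring]
  linarith

/-- `φ_fcc` is convex on `ℝ³` ("the convex positively homogeneous function of degree one", (20)).
[cite: CicaleseKreutzLeonardi2023, §2 (20)] -/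
theorem convexOn_phiFcc : ConvexOn ℝ Set.univ phiFcc := by
  refine ⟨convex_univ, fun ν _ μ _ a b ha hb _ => ?_⟩
  calc phiFcc (a • ν + b • μ) ≤ phiFcc (a • ν) + phiFcc (b • μ) := phiFcc_add_le _ _
    _ = a * phiFcc ν + b * phiFcc μ := by
        rw [phiFcc_smul, phiFcc_smul, abs_of_nonneg ha, abs_of_nonneg hb]
    _ = a • phiFcc ν + b • phiFcc μ := by simp only [smul_eq_mul]

/-- The squared Euclidean norm in coordinates. [folklore] -/
private theorem norm_sq_eq_three (ν : EuclideanSpace ℝ (Fin 3)) :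
    ‖ν‖ ^ 2 = |ν 0| ^ 2 + |ν 1| ^ 2 + |ν 2| ^ 2 := by
  rw [EuclideanSpace.norm_eq, Real.sq_sqrt (Finset.sum_nonneg fun i _ => sq_nonneg _),
    Fin.sum_univ_three]
  simp only [Real.norm_eq_abs]

/-- `3‖ν‖² ≤ φ_fcc(ν)²`: with sorted absolute coordinates `a ≥ b ≥ c`,
`(2a + b)² − 3(a² + b² + c²) ≥ (a − b)(a + 5b) ≥ 0`.  Geometrically: the in-radius of the Wulff body
`{‖ζ‖_∞ ≤ 2} ∩ {‖ζ‖₁ ≤ 3}` (the printed `{‖ζ‖_∞ ≤ 4} ∩ {‖ζ‖₁ ≤ 6}` halved) is `√3`, attained on its eight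
hexagonal `{111}` facets. [cite: CicaleseKreutzLeonardi2023, proof of Proposition 2.4, Step 3] -/
theorem three_mul_norm_sq_le_phiFcc_sq (ν : EuclideanSpace ℝ (Fin 3)) : 3 * ‖ν‖ ^ 2 ≤ phiFcc ν ^ 2 := by
  rw [norm_sq_eq_three, phiFcc_eq_sum_max]
  have h0 := abs_nonneg (ν 0); have h1 := abs_nonneg (ν 1); have h2 := abs_nonneg (ν 2)
  set a := |ν 0|; set b := |ν 1|; set c := |ν 2|
  rcases le_total a b with hab | hab <;> rcases le_total a c with hac | hac <;>
    rcases le_total b c with hbc | hbc <;>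
    simp only [max_eq_left, max_eq_right, hab, hac, hbc] <;>
    nlinarith [mul_nonneg h0 h1, mul_nonneg h0 h2, mul_nonneg h1 h2]

/-- `φ_fcc(ν)² ≤ 5‖ν‖²`: `5(a² + b² + c²) − (2a + b)² = (a − 2b)² + 5c² ≥ 0`.  Geometrically: the
circum-radius of the Wulff body `{‖ζ‖_∞ ≤ 2} ∩ {‖ζ‖₁ ≤ 3}` is `√5 = ‖(0, 1, 2)‖`, attained at its `24`
vertices. [cite: CicaleseKreutzLeonardi2023, proof of Proposition 2.4, Step 3] -/
theorem phiFcc_sq_le_five_mul_norm_sq (ν : EuclideanSpace ℝ (Fin 3)) : phiFcc ν ^ 2 ≤ 5 * ‖ν‖ ^ 2 := by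
  rw [norm_sq_eq_three, phiFcc_eq_sum_max]
  have h0 := abs_nonneg (ν 0); have h1 := abs_nonneg (ν 1); have h2 := abs_nonneg (ν 2)
  set a := |ν 0|; set b := |ν 1|; set c := |ν 2|
  rcases le_total a b with hab | hab <;> rcases le_total a c with hac | hac <;>
    rcases le_total b c with hbc | hbc <;>
    simp only [max_eq_left, max_eq_right, hab, hac, hbc] <;>
    nlinarith [sq_nonneg (a - 2 * b), sq_nonneg (b - 2 * a), sq_nonneg (a - 2 * c),
      sq_nonneg (c - 2 * a), sq_nonneg (b - 2 * c), sq_nonneg (c - 2 * b)]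

/-- **Lower comparison (sharp at the `{111}` normals):** `√3 ‖ν‖ ≤ φ_fcc(ν)` — the non-degeneracy
constant `c` of Definition 2.2 for `ϕ_FCC/2`, equal to the in-radius of the Wulff body.
[cite: CicaleseKreutzLeonardi2023, Definition 2.2 and proof of Proposition 2.4, Step 3] -/
theorem sqrt_three_mul_norm_le_phiFcc (ν : EuclideanSpace ℝ (Fin 3)) : Real.sqrt 3 * ‖ν‖ ≤ phiFcc ν := by
  have h1 : Real.sqrt 3 * ‖ν‖ = Real.sqrt (3 * ‖ν‖ ^ 2) := by
    rw [Real.sqrt_mul (by norm_num), Real.sqrt_sq (norm_nonneg _)]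
  rw [h1]
  calc Real.sqrt (3 * ‖ν‖ ^ 2) ≤ Real.sqrt (phiFcc ν ^ 2) :=
        Real.sqrt_le_sqrt (three_mul_norm_sq_le_phiFcc_sq ν)
    _ = phiFcc ν := Real.sqrt_sq (phiFcc_nonneg ν)

/-- **Upper comparison (sharp at the `{210}` normals):** `φ_fcc(ν) ≤ √5 ‖ν‖` — the non-degeneracy
constant `C` of Definition 2.2 for `ϕ_FCC/2`, equal to the circum-radius of the Wulff body.
[cite: CicaleseKreutzLeonardi2023, Definition 2.2 and proof of Proposition 2.4, Step 3] -/
theorem phiFcc_le_sqrt_five_mul_norm (ν : EuclideanSpace ℝ (Fin 3)) : phiFcc ν ≤ Real.sqrt 5 * ‖ν‖ := by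
  have h1 : Real.sqrt 5 * ‖ν‖ = Real.sqrt (5 * ‖ν‖ ^ 2) := by
    rw [Real.sqrt_mul (by norm_num), Real.sqrt_sq (norm_nonneg _)]
  rw [h1]
  calc phiFcc ν = Real.sqrt (phiFcc ν ^ 2) := (Real.sqrt_sq (phiFcc_nonneg ν)).symm
    _ ≤ Real.sqrt (5 * ‖ν‖ ^ 2) := Real.sqrt_le_sqrt (phiFcc_sq_le_five_mul_norm_sq ν)

/-- `φ_fcc(ν) = 0 ↔ ν = 0`: `φ_fcc` is non-degenerate in the sense of Definition 2.2 (indeed a norm on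
`ℝ³`, the dual of the printed polar (24)). [cite: CicaleseKreutzLeonardi2023, Definition 2.2 and Proposition 2.4 (24)] -/
theorem phiFcc_eq_zero_iff (ν : EuclideanSpace ℝ (Fin 3)) : phiFcc ν = 0 ↔ ν = 0 := by
  constructor
  · intro h
    have h3 := sqrt_three_mul_norm_le_phiFcc ν
    rw [h] at h3
    have hs : 0 < Real.sqrt 3 := by positivity
    have hn : ‖ν‖ ≤ 0 := by nlinarith [norm_nonneg ν]
    exact norm_eq_zero.1 (le_antisymm hn (norm_nonneg ν))
  · rintro rfl
    simp [phiFcc]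

/-- `φ_fcc(ν) > 0` for `ν ≠ 0` (non-degeneracy, Definition 2.2). [cite: CicaleseKreutzLeonardi2023, Definition 2.2 and Proposition 2.4 (24)] -/
theorem phiFcc_pos {ν : EuclideanSpace ℝ (Fin 3)} (hν : ν ≠ 0) : 0 < phiFcc ν :=
  lt_of_le_of_ne (phiFcc_nonneg ν) fun h => hν ((phiFcc_eq_zero_iff ν).1 h.symm)

/-! ### Values on the low-index normals (unnormalised integer normals; divide by `‖ν‖`) -/

/-- `φ_fcc` of the point with integer coordinates `v`. [folklore] -/
private theorem phiFcc_intVec (v : Fin 3 → ℤ) :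
    phiFcc (intVec v) = (|(v 0 : ℝ) + v 1| + |(v 0 : ℝ) - v 1| + |(v 0 : ℝ) + v 2| + |(v 0 : ℝ) - v 2| +
      |(v 1 : ℝ) + v 2| + |(v 1 : ℝ) - v 2|) / 2 := by
  simp [phiFcc]

/-- `φ_fcc(1,0,0) = 2`: a `{100}` cut costs `2` per unit area (printed `C(1)/a² = 8.00`).
[cite: WolfJaszczak1992, Table 26.1] -/
theorem phiFcc_100 : phiFcc (intVec ![1, 0, 0]) = 2 := by
  rw [phiFcc_intVec]; norm_num [Matrix.cons_val_two, Matrix.tail_cons, Matrix.head_cons]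

/-- `φ_fcc(1,1,0) = 3`, i.e. `3/√2 = 2.1213…` per unit area of a `{110}` cut (printed `C(1)/a² = 8.48`).
[cite: WolfJaszczak1992, Table 26.1] -/
theorem phiFcc_110 : phiFcc (intVec ![1, 1, 0]) = 3 := by
  rw [phiFcc_intVec]; norm_num [Matrix.cons_val_two, Matrix.tail_cons, Matrix.head_cons]

/-- `φ_fcc(1,1,1) = 3`, i.e. `√3 = 1.7320…` per unit area of a `{111}` cut (printed `C(1)/a² = 6.93`) —
the minimum over all orientations (`sqrt_three_mul_norm_le_phiFcc`). [cite: WolfJaszczak1992, Table 26.1] -/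
theorem phiFcc_111 : phiFcc (intVec ![1, 1, 1]) = 3 := by
  rw [phiFcc_intVec]; norm_num [Matrix.cons_val_two, Matrix.tail_cons, Matrix.head_cons]

/-- `φ_fcc(1,1,3) = 7`, i.e. `7/√11 = 2.1106…` per unit area of a `{113}` cut (printed `C(1)/a² = 8.44`).
[cite: WolfJaszczak1992, Table 26.1] -/
theorem phiFcc_113 : phiFcc (intVec ![1, 1, 3]) = 7 := by
  rw [phiFcc_intVec]; norm_num [Matrix.cons_val_two, Matrix.tail_cons, Matrix.head_cons]

/-- `φ_fcc(2,1,0) = 5`, i.e. `√5 = 2.2360…` per unit area of a `{210}` cut — the maximum over all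
orientations (`phiFcc_le_sqrt_five_mul_norm`): `(2, 1, 0)` is the direction of a vertex of the Wulff body
`{‖ζ‖_∞ ≤ 2} ∩ {‖ζ‖₁ ≤ 3}`. [cite: CicaleseKreutzLeonardi2023, proof of Proposition 2.4, Step 3] -/
theorem phiFcc_210 : phiFcc (intVec ![2, 1, 0]) = 5 := by
  rw [phiFcc_intVec]; norm_num [Matrix.cons_val_two, Matrix.tail_cons, Matrix.head_cons]

/-! ### The bond-counting form over the cuboctahedron -/

/-- The inner product of an integer point of `ℝ³` with `ν`, in coordinates. [folklore] -/
private theorem inner_intVec_left (v : Fin 3 → ℤ) (ν : EuclideanSpace ℝ (Fin 3)) :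
    ⟪intVec v, ν⟫ = (v 0 : ℝ) * ν 0 + (v 1 : ℝ) * ν 1 + (v 2 : ℝ) * ν 2 := by
  rw [EuclideanSpace.inner_eq_star_dotProduct]
  simp [dotProduct, Fin.sum_univ_three, intVec, mul_comm]

/-- `|−a + b| = |a − b|`. [folklore] -/
private theorem abs_neg_add_eq (a b : ℝ) : |-a + b| = |a - b| := by
  rw [← abs_neg]; ring_nf

/-- `|a + −b| = |a − b|`. [folklore] -/
private theorem abs_add_neg_eq (a b : ℝ) : |a + -b| = |a - b| := by
  ring_nf

/-- `|−a − b| = |a + b|`. [folklore] -/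
private theorem abs_neg_sub_eq (a b : ℝ) : |-a - b| = |a + b| := by
  rw [← abs_neg]; ring_nf


/-- The twelve bond terms: `Σ_{v ∈ fccInt} |⟨v, ν⟩| = 4 φ_fcc(ν)` over the integer bond vectors
`(±1, ±1, 0), …` (each of the six `|νᵢ ± νⱼ|` occurs for `v` and `−v`): the computation "Employing now
(10), we obtain (23)" of the printed proof. [cite: CicaleseKreutzLeonardi2023, proof of Proposition 2.4, Step 1] -/
theorem sum_fccInt_abs_inner (ν : EuclideanSpace ℝ (Fin 3)) :
    ∑ v ∈ fccInt, |⟪intVec v, ν⟫| = 4 * phiFcc ν := by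
  simp only [inner_intVec_left, fccInt, phiFcc]
  rw [Finset.sum_insert (by decide), Finset.sum_insert (by decide), Finset.sum_insert (by decide),
    Finset.sum_insert (by decide), Finset.sum_insert (by decide), Finset.sum_insert (by decide),
    Finset.sum_insert (by decide), Finset.sum_insert (by decide), Finset.sum_insert (by decide),
    Finset.sum_insert (by decide), Finset.sum_insert (by decide), Finset.sum_singleton]
  simp only [Matrix.cons_val_zero, Matrix.cons_val_one, Matrix.cons_val_two, Matrix.head_cons,
    Matrix.tail_cons, Int.cast_one, Int.cast_zero, Int.cast_neg, one_mul, zero_mul, neg_mul, add_zero,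
    zero_add, abs_neg_add_eq, abs_add_neg_eq, abs_neg_sub_eq]
  ring

/-- **Bond-counting form** (Mackenzie–Moore–Nicholas; Wolf–Jaszczak eq. (26.30); Step 1 of the printed
proof of (23)): `φ_fcc(ν) = (√2/4) · Σ_{b ∈ fccKissingPattern} |⟪b, ν⟫|`, the sum running over the
twelve unit bond vectors of the fcc packing (`fccKissingPattern = {v/√2 : v ∈ fccInt}`).
[cite: CicaleseKreutzLeonardi2023, proof of Proposition 2.4, Step 1] -/
theorem phiFcc_eq_bondSum (ν : EuclideanSpace ℝ (Fin 3)) :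
    phiFcc ν = Real.sqrt 2 / 4 * ∑ b ∈ fccKissingPattern, |⟪b, ν⟫| := by
  have h2 : (2 : ℕ) ≠ 0 := by norm_num
  unfold fccKissingPattern scaledPattern
  rw [Finset.sum_image (scaledPattern_map_injective h2).injOn]
  have hs : ∀ v ∈ fccInt,
      |⟪((Real.sqrt (2 : ℕ))⁻¹ • intVec v : EuclideanSpace ℝ (Fin 3)), ν⟫| =
        (Real.sqrt 2)⁻¹ * |⟪intVec v, ν⟫| := by
    intro v _
    rw [real_inner_smul_left, abs_mul, Nat.cast_ofNat, abs_of_nonneg (by positivity)]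
  rw [Finset.sum_congr rfl hs, ← Finset.mul_sum, sum_fccInt_abs_inner]
  have hpos : 0 < Real.sqrt 2 := by positivity
  rw [show Real.sqrt 2 / 4 * ((Real.sqrt 2)⁻¹ * (4 * phiFcc ν)) =
      Real.sqrt 2 * (Real.sqrt 2)⁻¹ * phiFcc ν by ring, mul_inv_cancel₀ hpos.ne', one_mul]

/-! ### The Wulff body: `φ_fcc` is the support function of the truncated octahedron `conv{perm(0, ±1, ±2)}` -/

/-- The `24` vertices `perm(0, ±1, ±2)` of the truncated octahedron `W = {‖ζ‖_∞ ≤ 2} ∩ {‖ζ‖₁ ≤ 3}` with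
`h_W = φ_fcc` (volume `32`; the normalisation used by the cell's planner, ROUTE.md «Numbers») — one half
of the printed Wulff set "`W_{ϕ_FCC}` is the intersection of a cube `‖ζ‖_∞ ≤ 4` with an octahedron
`‖ζ‖₁ ≤ 6`" (since `φ_fcc = ϕ_FCC/2`). [cite: CicaleseKreutzLeonardi2023, proof of Proposition 2.4, Step 3] -/
def truncOctVertexInt : Finset (Fin 3 → ℤ) :=
  {![0, 1, 2], ![0, 1, -2], ![0, -1, 2], ![0, -1, -2], ![0, 2, 1], ![0, 2, -1], ![0, -2, 1],
   ![0, -2, -1], ![1, 0, 2], ![1, 0, -2], ![-1, 0, 2], ![-1, 0, -2], ![2, 0, 1], ![2, 0, -1],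
   ![-2, 0, 1], ![-2, 0, -1], ![1, 2, 0], ![1, -2, 0], ![-1, 2, 0], ![-1, -2, 0], ![2, 1, 0],
   ![2, -1, 0], ![-2, 1, 0], ![-2, -1, 0]}

/-- Twenty-four vertices (a truncated octahedron: `6` square and `8` hexagonal facets, `24` vertices).
[cite: CicaleseKreutzLeonardi2023, proof of Proposition 2.4, Step 3] -/
theorem card_truncOctVertexInt : truncOctVertexInt.card = 24 := by decide

/-- Each vertex of `W` pairs against `ν` to at most `φ_fcc(ν)` (the easy half of `h_W = φ_fcc`).
[cite: CicaleseKreutzLeonardi2023, Proposition 2.4 (24) and its proof, Step 3] -/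
theorem inner_intVec_le_phiFcc (ν : EuclideanSpace ℝ (Fin 3)) {v : Fin 3 → ℤ}
    (hv : v ∈ truncOctVertexInt) : ⟪intVec v, ν⟫ ≤ phiFcc ν := by
  rw [inner_intVec_left, phiFcc_eq_sum_max]
  have a0 := le_abs_self (ν 0); have a1 := le_abs_self (ν 1); have a2 := le_abs_self (ν 2)
  have b0 := neg_le_abs (ν 0); have b1 := neg_le_abs (ν 1); have b2 := neg_le_abs (ν 2)
  have m01 := le_max_left |ν 0| |ν 1|; have m01' := le_max_right |ν 0| |ν 1|
  have m02 := le_max_left |ν 0| |ν 2|; have m02' := le_max_right |ν 0| |ν 2|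
  have m12 := le_max_left |ν 1| |ν 2|; have m12' := le_max_right |ν 1| |ν 2|
  simp only [truncOctVertexInt, Finset.mem_insert, Finset.mem_singleton] at hv
  rcases hv with rfl | rfl | rfl | rfl | rfl | rfl | rfl | rfl | rfl | rfl | rfl | rfl |
      rfl | rfl | rfl | rfl | rfl | rfl | rfl | rfl | rfl | rfl | rfl | rfl <;>
    simp only [Matrix.cons_val_zero, Matrix.cons_val_one, Matrix.cons_val_two, Matrix.head_cons,
      Matrix.tail_cons, Int.cast_one, Int.cast_zero, Int.cast_neg, Int.cast_ofNat] <;>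
    linarith

/-- The sign `±1` of a real number, as an integer (`+1` at `0`). [folklore] -/
private def sgnZ (t : ℝ) : ℤ := if 0 ≤ t then 1 else -1

/-- `sgnZ t · t = |t|`. [folklore] -/
private theorem cast_sgnZ_mul (t : ℝ) : (sgnZ t : ℝ) * t = |t| := by
  unfold sgnZ
  split_ifs with h
  · push_cast; rw [abs_of_nonneg h]; ring
  · push_cast; rw [abs_of_neg (lt_of_not_ge h)]; ring

/-- A vertex maximising `⟨·, ν⟩`: `±2` on a largest absolute coordinate of `ν`, `±1` on a second
largest, signs copied from `ν`. [folklore] -/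
private def bestVertex (ν : EuclideanSpace ℝ (Fin 3)) : Fin 3 → ℤ :=
  if |ν 1| ≤ |ν 0| then
    (if |ν 2| ≤ |ν 1| then ![2 * sgnZ (ν 0), sgnZ (ν 1), 0]
      else if |ν 2| ≤ |ν 0| then ![2 * sgnZ (ν 0), 0, sgnZ (ν 2)]
      else ![sgnZ (ν 0), 0, 2 * sgnZ (ν 2)])
  else
    (if |ν 2| ≤ |ν 0| then ![sgnZ (ν 0), 2 * sgnZ (ν 1), 0]
      else if |ν 2| ≤ |ν 1| then ![0, 2 * sgnZ (ν 1), sgnZ (ν 2)]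
      else ![0, sgnZ (ν 1), 2 * sgnZ (ν 2)])

/-- `bestVertex ν` is one of the `24` vertices. [folklore] -/
private theorem bestVertex_mem (ν : EuclideanSpace ℝ (Fin 3)) : bestVertex ν ∈ truncOctVertexInt := by
  unfold bestVertex sgnZ
  split_ifs <;> decide

/-- `⟨bestVertex ν, ν⟩ = φ_fcc(ν)`. [folklore] -/
private theorem inner_bestVertex (ν : EuclideanSpace ℝ (Fin 3)) : ⟪intVec (bestVertex ν), ν⟫ = phiFcc ν := by
  have e0 := cast_sgnZ_mul (ν 0); have e1 := cast_sgnZ_mul (ν 1); have e2 := cast_sgnZ_mul (ν 2)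
  have a0 := abs_nonneg (ν 0); have a1 := abs_nonneg (ν 1); have a2 := abs_nonneg (ν 2)
  rw [inner_intVec_left, phiFcc_eq_sum_max]
  unfold bestVertex
  split_ifs with h1 h2 h3 h4 h5 <;>
    simp only [Matrix.cons_val_zero, Matrix.cons_val_one, Matrix.cons_val_two, Matrix.head_cons,
      Matrix.tail_cons, Int.cast_mul, Int.cast_ofNat, Int.cast_zero, zero_mul, add_zero, zero_add,
      mul_assoc, e0, e1, e2] <;>
    simp only [not_le] at * <;>
    simp only [max_def] <;> split_ifs <;> linarith

/-- Some vertex of `W` attains `φ_fcc(ν)` (the other half of `h_W = φ_fcc`: "any linear function attains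
its maximum at the extreme points of a convex set", printed proof). [cite: CicaleseKreutzLeonardi2023, proof of Proposition 2.4, Steps 2–3] -/
theorem exists_truncOctVertex_inner_eq_phiFcc (ν : EuclideanSpace ℝ (Fin 3)) :
    ∃ v ∈ truncOctVertexInt, ⟪intVec v, ν⟫ = phiFcc ν :=
  ⟨bestVertex ν, bestVertex_mem ν, inner_bestVertex ν⟩

/-- **`φ_fcc` is the support function of the truncated octahedron** on its vertex set:
`φ_fcc(ν) = max_{v ∈ perm(0,±1,±2)} ⟨v, ν⟩` — the density is the support function of its Wulff set
`W_ϕ = {ϕ° ≤ 1}`, here `{‖ζ‖_∞ ≤ 2} ∩ {‖ζ‖₁ ≤ 3}` by the printed polar (24) (halved).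
[cite: CicaleseKreutzLeonardi2023, Proposition 2.4 (24)] -/
theorem phiFcc_eq_sup_truncOctVertex (ν : EuclideanSpace ℝ (Fin 3)) :
    phiFcc ν = truncOctVertexInt.sup' ⟨![0, 1, 2], by decide⟩ (fun v => ⟪intVec v, ν⟫) := by
  apply le_antisymm
  · obtain ⟨v, hv, hvν⟩ := exists_truncOctVertex_inner_eq_phiFcc ν
    rw [← hvν]
    exact Finset.le_sup' (fun v => ⟪intVec v, ν⟫) hv
  · exact Finset.sup'_le _ _ fun v hv => inner_intVec_le_phiFcc ν hv

/-- **The fcc Wulff body** in the normalisation `h_W = φ_fcc`: the truncated octahedron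
`W = conv{perm(0, ±1, ±2)} = {‖ζ‖_∞ ≤ 2} ∩ {‖ζ‖₁ ≤ 3}` (eight hexagonal `{111}` facets at support
distance `√3`, six square `{100}` facets at distance `2`; volume `32`) — the printed
`W_{ϕ_FCC} = {‖ζ‖_∞ ≤ 4} ∩ {‖ζ‖₁ ≤ 6}` scaled by `½`. Given here as the convex hull of its vertices.
[cite: CicaleseKreutzLeonardi2023, Proposition 2.4 (24) and its proof, Step 3] -/
def fccWulffBody : Set (EuclideanSpace ℝ (Fin 3)) :=
  convexHull ℝ (intVec '' (↑truncOctVertexInt : Set (Fin 3 → ℤ)))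

/-- The vertices lie in the body. [folklore] -/
private theorem intVec_mem_fccWulffBody {v : Fin 3 → ℤ} (hv : v ∈ truncOctVertexInt) :
    intVec v ∈ fccWulffBody :=
  subset_convexHull ℝ _ ⟨v, hv, rfl⟩

/-- Support inequality on the whole body: `⟨x, ν⟩ ≤ φ_fcc(ν)` for every `x ∈ W` ("any linear function
attains its maximum at the extreme points of a convex set", printed proof, Step 2).
[cite: CicaleseKreutzLeonardi2023, Proposition 2.4 (24) and its proof, Step 2] -/
theorem inner_le_phiFcc_of_mem_fccWulffBody (ν : EuclideanSpace ℝ (Fin 3)) {x : EuclideanSpace ℝ (Fin 3)}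
    (hx : x ∈ fccWulffBody) : ⟪x, ν⟫ ≤ phiFcc ν := by
  have hf : ConvexOn ℝ Set.univ (innerₛₗ ℝ ν : EuclideanSpace ℝ (Fin 3) →ₗ[ℝ] ℝ) :=
    (innerₛₗ ℝ ν).convexOn convex_univ
  obtain ⟨y, ⟨v, hv, rfl⟩, hxy⟩ := hf.exists_ge_of_mem_convexHull (Set.subset_univ _) hx
  simp only [innerₛₗ_apply_apply] at hxy
  have hvφ := inner_intVec_le_phiFcc ν hv
  rw [real_inner_comm] at hvφ ⊢
  exact hxy.trans hvφ

/-- Hence `φ_fcc(ν)` is exactly the support value `h_W(ν) = max_{x ∈ W} ⟨x, ν⟩` of the Wulff body: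
attained at a vertex, never exceeded on `W` (the cell planner's "`wulffSupport = phiFcc`"; in print: the
density equals the support function of `W_ϕ = {ϕ° ≤ 1}`, (24)).
[cite: CicaleseKreutzLeonardi2023, Proposition 2.4 (24)] -/
theorem isGreatest_inner_fccWulffBody (ν : EuclideanSpace ℝ (Fin 3)) :
    IsGreatest ((fun x => ⟪x, ν⟫) '' fccWulffBody) (phiFcc ν) := by
  obtain ⟨v, hv, hvν⟩ := exists_truncOctVertex_inner_eq_phiFcc ν
  exact ⟨⟨intVec v, intVec_mem_fccWulffBody hv, hvν⟩,
    fun _ ⟨x, hx, hxr⟩ => hxr ▸ inner_le_phiFcc_of_mem_fccWulffBody ν hx⟩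

end Literature.MathematicalPhysics.StatisticalMechanics

end
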